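import Summits.ResolutionOfSingularities.ResolutionOfSingularities.Theorems.EquisingularLiftEquisingularLiftNatF102IdealLineBundle
import Summits.ResolutionOfSingularities.ResolutionOfSingularities.Theorems.EquisingularLiftEquisingularLiftNatF102CoordinatesOfIso
import Summits.ResolutionOfSingularities.ResolutionOfSingularities.Theorems.EquisingularLiftEquisingularLiftNatF102FibreTransport
import Summits.ResolutionOfSingularities.ResolutionOfSingularities.Theorems.EquisingularLiftEquisingularLiftNatDirectionFrames
import Literature.AlgebraicGeometry.Modules.IsoOfFrames
import Literature.AlgebraicGeometry.Motives.ProjectiveLineUniformisers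
import HarnessLib

/-!
# [OURS · L1 W4.5(b) · LINE (T-j)-PROOF · BRICK B4 (γ*) — brick (γ)] On `ℙ¹_{k'}` the ideals of the two rational points
# `y₀ ∈ D₊(x₀)` and `y₁ ∈ D₊(x₁)` are isomorphic `𝒪_{ℙ¹}`-modules: `𝓘_{y₀} ≅ 𝓘_{y₁}`

Crux EL♮(3) = stmt-ResolutionOfSingularities-20148, route EquisingularLift, LINE (T-j)-PROOF (F-102), brick B4 (γ*) = res-L1-w45b-lead-2's
`nonempty_pullback_sheafHom_idealModule_iso_unit` (skeleton `L/res-L1-w45b-lead-2/F102-GammaStarSkeleton.lean` 7d8d5eef49743d69), brick **(γ)**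
`nonempty_idealModule_ptHom_iso` (signature VERBATIM, `brick_` dropped). Hand res-rescue-typ-5 g3 (desk 22:38:49Z / lead-2 CUT 22:41:35Z).
`--supports stmt-ResolutionOfSingularities-20148 --as helper`. OURS; NOT a statement of any manuscript; AI-written, weaker than expert review.
No `sorry`; standard axioms; DEF-FREE.

PROOF (Hartshorne II Prop. 6.4 / Cor. 6.17 in miniature: both ideals are `𝒪(−1)`). On the two standard charts `U_i = D₊(x_i)` of
`ℙ¹ = Proj k'[x₀, x₁]` the ideal `𝓘_{y_j}` of the rational point `y_j` (`ProjLine.ptHom k' j`, the point of `D₊(x_j)` where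
`sec j = x_{1−j}/x_j` vanishes) is generated by `g_{j,i} := sec j` if `i = j` (`ProjLine.primeIdealOf_y`) and by `1` if `i ≠ j`
(`y_j ∉ D₊(x_{1−j})`, `ProjLine.y_other_not_mem`). By (a1) (`F102.nonempty_basis_sections_idealModule_of_span_singleton`) each `𝓘_{y_j}|_{U_i}` is
framed by a basis section READING to `g_{j,i}` (`F102.toRing_idealModuleι_injective` makes readings faithful). On `U₀ ∩ U₁` one has
`sec 0 · sec 1 = 1` (in the function field: `τ₀ τ₁ = t·t⁻¹`), so for BOTH `j` the basis section over `U_b` restricts to `c_{ab}` times the one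
over `U_a` with the SAME scalar `c_{01} = sec 1|`, `c_{10} = sec 0|`, `c_{aa} = 1`; hence the two families of frames have equal transition
matrices and `isoOfFrames` (Literature `Modules/IsoOfFrames`, Hartshorne II Ex. 5.18) glues `𝓘_{y₀} ≅ 𝓘_{y₁}`.
-/

set_option linter.dupNamespace false -- mandated namespace `Summit.<Summit>.<Problem>` of this single-conjunct summit

noncomputable section

open CategoryTheory CategoryTheory.Limits AlgebraicGeometry Opposite TopologicalSpace IsLocalRing
open Literature.AlgebraicGeometry.Modules Literature.AlgebraicGeometry.Morphisms
open Literature.AlgebraicGeometry.Deformation Literature.AlgebraicGeometry.Motives Literature.AlgebraicGeometry.HodgeTheory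
open MvPolynomial

universe u

namespace Summit.ResolutionOfSingularities.ResolutionOfSingularities.Cruxes.EquisingularLiftNat.F102

attribute [local instance] MvPolynomial.gradedAlgebra

/-! ## 1. The two charts of `ℙ¹` and the point ideals on them -/

section Charts

variable (k : Type u) [Field k]

/-- `other (other i) = i` on `Fin 2`. [folklore] -/
theorem ProjLine.other_other (i : Fin 2) : ProjLine.other (ProjLine.other i) = i := by
  fin_cases i <;> rfl

/-- `ptᵢ : Spec k → ℙ¹` is a closed immersion (a section of the separated structure morphism). [folklore] -/
theorem ProjLine.isClosedImmersion_ptHom (i : Fin 2) : IsClosedImmersion (ProjLine.ptHom k i) := by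
  haveI : IsProper (Segre.toSpec (Fin 2) k) := ProjLine.isProper_toSpec k
  haveI : IsClosedImmersion (ProjLine.ptHom k i ≫ Segre.toSpec (Fin 2) k) := by
    rw [ProjLine.ptHom_toSpec]
    exact IsClosedImmersion.spec_of_surjective _ (fun a => ⟨a, rfl⟩)
  exact IsClosedImmersion.of_comp (ProjLine.ptHom k i) (Segre.toSpec (Fin 2) k)

/-- `ℙ¹_k` is locally Noetherian. [folklore] -/
theorem ProjLine.isLocallyNoetherian_P : IsLocallyNoetherian (ProjLine.P k) := by
  haveI : IsProper (Segre.toSpec (Fin 2) k) := ProjLine.isProper_toSpec k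
  exact LocallyOfFiniteType.isLocallyNoetherian (Segre.toSpec (Fin 2) k)

/-- **The ideal of `ptᵢ` on its own chart `D₊(xᵢ)` is generated by `x_j/x_i`.** [folklore] -/
theorem ProjLine.ker_ideal_ptHom_self (i : Fin 2) :
    (ProjLine.ptHom k i).ker.ideal ⟨Proj.basicOpen (ProjLine.A k) (X i), ProjLine.isAffineOpen_basicOpen_X k i⟩ =
      Ideal.span {ProjLine.sec k i} := by
  rw [← ProjLine.primeIdealOf_y, ProjLine.primeIdealOf_y_eq_ker, Scheme.Hom.ker_apply]
  -- both are kernels of `s ↦ s(ptᵢ)`, read in `Γ(Spec k, pt⁻¹D₊(xᵢ))` resp. in `k`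
  ext s
  simp only [RingHom.mem_ker]
  have happLE : ((ProjLine.ptHom k i).appLE (Proj.basicOpen (ProjLine.A k) (X i)) ⊤
      (ProjLine.top_le_preimage_ptHom k i)).hom s =
      ((Spec (.of k)).presheaf.map (homOfLE (ProjLine.top_le_preimage_ptHom k i)).op).hom
        (((ProjLine.ptHom k i).app (Proj.basicOpen (ProjLine.A k) (X i))).hom s) := rfl
  have hinj1 : Function.Injective
      ((Spec (.of k)).presheaf.map (homOfLE (ProjLine.top_le_preimage_ptHom k i)).op).hom := by
    have heq := ProjLine.preimage_ptHom_basicOpen k i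
    have : homOfLE (ProjLine.top_le_preimage_ptHom k i) = eqToHom heq.symm := Subsingleton.elim _ _
    rw [this, eqToHom_op, eqToHom_map, ← eqToIso.hom]
    exact (eqToIso _).commRingCatIsoToRingEquiv.injective
  have hinj2 : Function.Injective (Scheme.ΓSpecIso (.of k)).hom.hom :=
    (Scheme.ΓSpecIso (.of k)).commRingCatIsoToRingEquiv.injective
  change ((ProjLine.ptHom k i).app (Proj.basicOpen (ProjLine.A k) (X i))).hom s = 0 ↔
    (Scheme.ΓSpecIso (.of k)).hom.hom (((ProjLine.ptHom k i).appLE (Proj.basicOpen (ProjLine.A k) (X i)) ⊤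
      (ProjLine.top_le_preimage_ptHom k i)).hom s) = 0
  rw [happLE]
  constructor
  · intro h0; rw [h0, map_zero, map_zero]
  · intro h0; exact hinj1 (hinj2 (by rw [h0, map_zero, map_zero]))

/-- `ptᵢ` misses the other chart: `ptᵢ⁻¹ D₊(x_j) = ∅` for `j ≠ i`. [folklore] -/
theorem ProjLine.preimage_ptHom_basicOpen_other (i : Fin 2) :
    (ProjLine.ptHom k i) ⁻¹ᵁ Proj.basicOpen (ProjLine.A k) (X (ProjLine.other i)) = ⊥ := by
  ext z
  simp only [Scheme.Hom.coe_preimage, Set.mem_preimage, SetLike.mem_coe, Opens.coe_bot, Set.mem_empty_iff_false,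
    iff_false]
  rw [Subsingleton.elim z (closedPoint k)]
  have h := ProjLine.y_other_not_mem k (ProjLine.other i)
  rw [ProjLine.other_other] at h
  exact h

/-- **The ideal of `ptᵢ` on the other chart is the unit ideal** (`= (1)`). [folklore] -/
theorem ProjLine.ker_ideal_ptHom_other (i : Fin 2) :
    (ProjLine.ptHom k i).ker.ideal ⟨Proj.basicOpen (ProjLine.A k) (X (ProjLine.other i)),
        ProjLine.isAffineOpen_basicOpen_X k (ProjLine.other i)⟩ = Ideal.span {1} := by
  rw [Ideal.span_singleton_one, eq_top_iff]
  intro a _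
  rw [Scheme.Hom.ker_apply, RingHom.mem_ker]
  haveI := subsingleton_sections_preimage_of_eq_bot (ProjLine.ptHom k i) _ (ProjLine.preimage_ptHom_basicOpen_other k i)
  exact Subsingleton.elim _ _

/-- **`(x₁/x₀)| · (x₀/x₁)| = 1` on any open `V` below `D₊(x₀)` and `D₊(x₁)`** (for `V ≠ ∅` checked in the function field:
`τ₀ τ₁ = t · t⁻¹ = 1`; for `V = ∅` the ring of sections is trivial). [folklore] -/
theorem ProjLine.sec_mul_sec {V : (ProjLine.P k).Opens} (i₀ : V ⟶ Proj.basicOpen (ProjLine.A k) (X 0))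
    (i₁ : V ⟶ Proj.basicOpen (ProjLine.A k) (X 1)) :
    (ProjLine.P k).presheaf.map i₀.op (ProjLine.sec k 0) * (ProjLine.P k).presheaf.map i₁.op (ProjLine.sec k 1) = 1 := by
  by_cases hV : (V : Set (ProjLine.P k)).Nonempty
  · have hη : genericPoint (ProjLine.P k) ∈ V :=
      ((genericPoint_spec (ProjLine.P k)).mem_open_set_iff V.2).mpr (by simpa using hV)
    haveI : Nonempty V := ⟨⟨_, hη⟩⟩
    apply (ProjLine.P k).germToFunctionField_injective V
    rw [map_mul, map_one]
    have h0 : (ProjLine.P k).germToFunctionField V ((ProjLine.P k).presheaf.map i₀.op (ProjLine.sec k 0)) = ProjLine.τ k 0 := by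
      rw [← ProjLine.germToFunctionField_sec]
      exact TopCat.Presheaf.germ_res_apply (ProjLine.P k).presheaf i₀ _ _ _
    have h1 : (ProjLine.P k).germToFunctionField V ((ProjLine.P k).presheaf.map i₁.op (ProjLine.sec k 1)) = ProjLine.τ k 1 := by
      rw [← ProjLine.germToFunctionField_sec]
      exact TopCat.Presheaf.germ_res_apply (ProjLine.P k).presheaf i₁ _ _ _
    rw [h0, h1, ProjLine.τ_zero, ProjLine.τ_one, mul_inv_cancel₀ (ProjLine.t_ne_zero k)]
  · have hbot : V = ⊥ := by
      ext z
      simp only [Opens.coe_bot, Set.mem_empty_iff_false, iff_false]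
      exact fun hz => hV ⟨z, hz⟩
    haveI : Subsingleton Γ(ProjLine.P k, V) := by
      rw [hbot]; exact CommRingCat.subsingleton_of_isTerminal (ProjLine.P k).sheaf.isTerminalOfEmpty
    exact Subsingleton.elim _ _

/-- The generator of `𝓘_{y_j}` on the chart `D₊(xᵢ)`: `x_{1-j}/x_j` if `i = j`, else `1`. [folklore] -/
theorem ProjLine.exists_generator (j i : Fin 2) :
    ∃ g : Γ(ProjLine.P k, Proj.basicOpen (ProjLine.A k) (X i)),
      (∀ a : Γ(ProjLine.P k, Proj.basicOpen (ProjLine.A k) (X i)), a * g = 0 → a = 0) ∧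
      Ideal.span {g} = (ProjLine.ptHom k j).ker.ideal ⟨Proj.basicOpen (ProjLine.A k) (X i), ProjLine.isAffineOpen_basicOpen_X k i⟩ ∧
      g = (if i = j then ProjLine.sec k i else 1) := by
  refine ⟨if i = j then ProjLine.sec k i else 1, fun a ha => ?_, ?_, rfl⟩
  · -- `Γ(ℙ¹, D₊(xᵢ))` is a domain and the generator is nonzero
    have hne : (if i = j then ProjLine.sec k i else 1 : Γ(ProjLine.P k, Proj.basicOpen (ProjLine.A k) (X i))) ≠ 0 := by
      split_ifs
      · intro h0
        have h1 := ProjLine.germToFunctionField_sec k i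
        rw [h0, map_zero] at h1
        exact ProjLine.τ_ne_zero k i h1.symm
      · exact one_ne_zero
    exact (mul_eq_zero.mp ha).resolve_right hne
  · split_ifs with hij
    · subst hij; exact (ProjLine.ker_ideal_ptHom_self k i).symm
    · have hi : i = ProjLine.other j := by
        fin_cases i <;> fin_cases j <;> first | exact absurd rfl hij | rfl
      subst hi
      exact (ProjLine.ker_ideal_ptHom_other k j).symm

end Charts

/-! ## 2. Frames of `𝓘_{y_j}` on the charts with prescribed readings -/

section Frames

variable (k : Type u) [Field k]

/-- **A rank-one frame of an ideal module `𝓘_s` over an affine `V` whose basis section READS to a given generator** `g` of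
`𝓘_s(V)` (a non-zero-divisor): (a1) basis of the sections + `nonempty_free_iso_over_of_basis` + reframing `exists_frame_of_basis`. [folklore] -/
theorem exists_frame_reading_of_span_singleton {X T : Scheme.{u}} [IsLocallyNoetherian X] (s : T ⟶ X) [IsClosedImmersion s]
    (V : X.affineOpens) (g : Γ(X, (V : X.Opens))) (hg : ∀ a : Γ(X, (V : X.Opens)), a * g = 0 → a = 0)
    (hI : Ideal.span {g} = s.ker.ideal V) :
    ∃ e : SheafOfModules.free PUnit.{u + 1} ≅ (idealModule s).over (V : X.Opens),
      toRing (idealModuleι s) (V : X.Opens) (basisSection e PUnit.unit) = g := by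
  obtain ⟨b, hb⟩ := nonempty_basis_sections_idealModule_of_span_singleton s V g hg hI
  obtain ⟨e₀⟩ := nonempty_free_iso_over_of_basis _ (coh_idealModule s).loc V.2 b
  obtain ⟨e, he⟩ := P1VB.exists_frame_of_basis e₀ b
  exact ⟨e, by rw [he]; exact hb⟩

/-- **Transition scalar from readings.** For rank-one frames `e`, `e′` of an ideal module `𝓘_s` over `W`, `W′` and an open `V` below both:
if the reading of `b′` restricts to `c` times the reading of `b` on `V`, then `T(e, e′) = c`. [folklore] -/
theorem transition_eq_of_readings {X T : Scheme.{u}} (s : T ⟶ X) {W W' V : X.Opens} (kW : V ⟶ W) (kW' : V ⟶ W')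
    (e : SheafOfModules.free PUnit.{u + 1} ≅ (idealModule s).over W)
    (e' : SheafOfModules.free PUnit.{u + 1} ≅ (idealModule s).over W') (c : Γ(X, V))
    (h : X.presheaf.map kW'.op (toRing (idealModuleι s) W' (basisSection e' PUnit.unit)) =
      c * X.presheaf.map kW.op (toRing (idealModuleι s) W (basisSection e PUnit.unit))) :
    transition e e' kW kW' PUnit.unit PUnit.unit = c := by
  classical
  have hsec : (idealModule s).presheaf.map kW'.op (basisSection e' PUnit.unit) =
      c • (idealModule s).presheaf.map kW.op (basisSection e PUnit.unit) := by
    apply toRing_idealModuleι_injective s V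
    rw [toRing_smul, ← map_toRing, ← map_toRing, h]
  rw [transition_apply, hsec, coord_smul, coord_map_basisSection, if_pos rfl, mul_one]

/-! ## 3. The isomorphism -/

/-- **(γ)** `𝓘_{(1:0)} ≅ 𝓘_{(0:1)}` on `ℙ¹_{k'}` — lead-2's brick (γ) of B4 (γ*), signature verbatim. [cite: Hartshorne1977, II Ex. 5.18 and
II Cor. 6.17] [OURS · glue] toward `F102.nonempty_pullback_sheafHom_idealModule_iso_unit` (stmt-ResolutionOfSingularities-20148); NOT a statement of
the manuscript. -/
theorem nonempty_idealModule_ptHom_iso (k' : Type) [Field k'] :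
    Nonempty (idealModule (ProjLine.ptHom k' 0) ≅ idealModule (ProjLine.ptHom k' 1)) := by
  classical
  haveI := ProjLine.isLocallyNoetherian_P k'
  haveI := fun j => ProjLine.isClosedImmersion_ptHom k' j
  -- the two-chart cover
  let U : Fin 2 → (ProjLine.P k').Opens := fun i => Proj.basicOpen (ProjLine.A k') (X i)
  have hU : iSup U = ⊤ := by
    refine top_le_iff.mp fun z _ => ?_
    obtain ⟨i, hz⟩ := ProjLine.exists_mem_basicOpen_X k' z
    exact Opens.mem_iSup.mpr ⟨i, hz⟩
  -- frames with prescribed readings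
  have hfr : ∀ j i : Fin 2, ∃ e : SheafOfModules.free PUnit.{1} ≅ (idealModule (ProjLine.ptHom k' j)).over (U i),
      toRing (idealModuleι (ProjLine.ptHom k' j)) (U i) (basisSection e PUnit.unit) =
        (if i = j then ProjLine.sec k' i else 1) := fun j i => by
    obtain ⟨g, hg, hI, hgdef⟩ := ProjLine.exists_generator k' j i
    obtain ⟨e, he⟩ := exists_frame_reading_of_span_singleton (ProjLine.ptHom k' j)
      ⟨U i, ProjLine.isAffineOpen_basicOpen_X k' i⟩ g hg hI
    exact ⟨e, he.trans hgdef⟩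
  choose e he using hfr
  -- readings restricted to an overlap
  have hread : ∀ (j b : Fin 2) {V : (ProjLine.P k').Opens} (κ : V ⟶ U b),
      (ProjLine.P k').presheaf.map κ.op (toRing (idealModuleι (ProjLine.ptHom k' j)) (U b) (basisSection (e j b) PUnit.unit)) =
        (ProjLine.P k').presheaf.map κ.op (if b = j then ProjLine.sec k' b else 1) := fun j b V κ => by rw [he]
  refine ⟨isoOfFrames U (I := fun _ => PUnit.{1}) (fun a => e 0 a) (fun a => e 1 a) (fun a b => ?_) hU⟩
  ext ⟨⟩ ⟨⟩
  -- both transition scalars equal the same function on `U a ∩ U b`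
  have ha : a = 0 ∨ a = 1 := by fin_cases a <;> simp
  have hb : b = 0 ∨ b = 1 := by fin_cases b <;> simp
  rcases ha with rfl | rfl <;> rcases hb with rfl | rfl
  · -- (0,0)
    rw [Subsingleton.elim (Opens.infLERight (U 0) (U 0)) (Opens.infLELeft (U 0) (U 0)),
      transition_eq_of_readings (ProjLine.ptHom k' 0) (Opens.infLELeft (U 0) (U 0)) (Opens.infLELeft (U 0) (U 0))
        (e 0 0) (e 0 0) 1 (by rw [one_mul]),
      transition_eq_of_readings (ProjLine.ptHom k' 1) (Opens.infLELeft (U 0) (U 0)) (Opens.infLELeft (U 0) (U 0))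
        (e 1 0) (e 1 0) 1 (by rw [one_mul])]
  · -- (0,1): `c = sec 1|`
    have hprod := ProjLine.sec_mul_sec k' (Opens.infLELeft (U 0) (U 1)) (Opens.infLERight (U 0) (U 1))
    rw [transition_eq_of_readings (ProjLine.ptHom k' 0) (Opens.infLELeft (U 0) (U 1)) (Opens.infLERight (U 0) (U 1))
        (e 0 0) (e 0 1) ((ProjLine.P k').presheaf.map (Opens.infLERight (U 0) (U 1)).op (ProjLine.sec k' 1))
        (by rw [hread 0 1, hread 0 0]; simp only [Fin.isValue, one_ne_zero, ↓reduceIte, map_one]; rw [mul_comm, hprod]),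
      transition_eq_of_readings (ProjLine.ptHom k' 1) (Opens.infLELeft (U 0) (U 1)) (Opens.infLERight (U 0) (U 1))
        (e 1 0) (e 1 1) ((ProjLine.P k').presheaf.map (Opens.infLERight (U 0) (U 1)).op (ProjLine.sec k' 1))
        (by rw [hread 1 1, hread 1 0]; simp only [Fin.isValue, zero_ne_one, ↓reduceIte, map_one, mul_one])]
  · -- (1,0): `c = sec 0|`
    have hprod := ProjLine.sec_mul_sec k' (Opens.infLERight (U 1) (U 0)) (Opens.infLELeft (U 1) (U 0))
    rw [transition_eq_of_readings (ProjLine.ptHom k' 0) (Opens.infLELeft (U 1) (U 0)) (Opens.infLERight (U 1) (U 0))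
        (e 0 1) (e 0 0) ((ProjLine.P k').presheaf.map (Opens.infLERight (U 1) (U 0)).op (ProjLine.sec k' 0))
        (by rw [hread 0 0, hread 0 1]; simp only [Fin.isValue, one_ne_zero, ↓reduceIte, map_one, mul_one]),
      transition_eq_of_readings (ProjLine.ptHom k' 1) (Opens.infLELeft (U 1) (U 0)) (Opens.infLERight (U 1) (U 0))
        (e 1 1) (e 1 0) ((ProjLine.P k').presheaf.map (Opens.infLERight (U 1) (U 0)).op (ProjLine.sec k' 0))
        (by rw [hread 1 0, hread 1 1]; simp only [Fin.isValue, zero_ne_one, ↓reduceIte, map_one]; rw [hprod])]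
  · -- (1,1)
    rw [Subsingleton.elim (Opens.infLERight (U 1) (U 1)) (Opens.infLELeft (U 1) (U 1)),
      transition_eq_of_readings (ProjLine.ptHom k' 0) (Opens.infLELeft (U 1) (U 1)) (Opens.infLELeft (U 1) (U 1))
        (e 0 1) (e 0 1) 1 (by rw [one_mul]),
      transition_eq_of_readings (ProjLine.ptHom k' 1) (Opens.infLELeft (U 1) (U 1)) (Opens.infLELeft (U 1) (U 1))
        (e 1 1) (e 1 1) 1 (by rw [one_mul])]

end Frames

end Summit.ResolutionOfSingularities.ResolutionOfSingularities.Cruxes.EquisingularLiftNat.F102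

end
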